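import Literature.Probability.Process.BrownianMotion
import Literature.Probability.Process.KolmogorovChentsovHolder
import Mathlib.Probability.Moments.SubGaussian
import HarnessLib

/-!
# Lévy's modulus of continuity of Brownian motion (upper bound)

Trunk T-STOCH support (stochastic processes). For the canonical Brownian motion `Literature.Probability.Process.brownian`
on `(ℝ≥0 → ℝ, Literature.preWienerMeasure)` (`Literature/Probability/Process/BrownianMotion.lean`) we
prove the upper half of **Lévy's modulus of continuity** (P. Lévy (1937); Lawler, *Conformally
Invariant Processes in the Plane* (2005), §1.13, Prop. 1.37 and Cor. 1.38; Le Gall (2016), proof of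
Thm. 2.9 / Lemma 2.10 for the chaining): for every horizon `N`, almost surely

* (`ae_exists_modulus_scale`) there is a level `n₀` such that
  `|B(s) - B(t)| ≤ levyConst · scaleBound (n + 1)` for all `n ≥ n₀` and `s, t ≤ N` with
  `|s - t| < 2⁻ⁿ`, where `scaleBound m = 2 √(m 2⁻ᵐ)`;
* (`ae_exists_modulus_dyadic`, the form of hypothesis (4.28) of Lawler's Lemma 4.33 used in the
  proof that the SLE trace is a curve) there are `c ≥ 0` and `j₀` with
  `|B(t + s) - B(t)| ≤ c √j 2^{-j}` for `j ≥ j₀`, `t ≤ N`, `s ≤ 4^{-j}`;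
* (`ae_exists_modulus`, classical form) there is `h₀ > 0` with
  `|B(s) - B(t)| ≤ C √(|s - t| log(1/|s - t|))` for `s, t ≤ N`, `|s - t| ≤ h₀`, with the explicit
  (non-sharp) constant `C = levyConst √(8 / log 2)`.

The proof uses only the Gaussian tails of single increments (Chernoff bound via Mathlib's
`ProbabilityTheory.HasSubgaussianMGF.measure_ge_le`; no independence), a Borel–Cantelli
argument over the `N 2ᵐ` level-`m` dyadic increments of `[0, N]` with threshold
`scaleBound m` (failure probability `≤ 2N (2/e²)ᵐ`, summable), the dyadic chaining lemma
`Literature.Probability.Process.KolmogorovChentsov.edist_le_tsum_of_increments_le` with the tail estimate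
`∑_{l > n} scaleBound l ≤ scaleBound (n+1) ∑ᵢ √((1+i)/2ⁱ)`, and path continuity to pass from
dyadic to all times. If the existence fact `Literature.Probability.Process.exists_isBrownianReal_measurable_continuous`
behind `brownian` fails, `brownian` is the zero process (its documented junk value) and all
statements hold trivially, so no hypothesis is needed.

## References

* P. Lévy, *Théorie de l'addition des variables aléatoires*, Gauthier-Villars (1937), §52.
* G. F. Lawler, *Conformally Invariant Processes in the Plane*, AMS (2005), §1.13, Prop. 1.37,
  Cor. 1.38, Lemma 4.33 (4.28).
* J.-F. Le Gall, *Brownian Motion, Martingales, and Stochastic Calculus*, GTM 274 (2016),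
  Thm 2.9, Lemma 2.10.
-/

open MeasureTheory ProbabilityTheory Filter Set
open scoped ENNReal NNReal Topology

namespace Literature.Probability.Process

namespace LevyModulus

open KolmogorovChentsov

/-! ### Gaussian tails -/

/-- A real random variable with centred Gaussian law `𝓝(0, v)` has sub-Gaussian moment generating
function with parameter `v` (indeed `mgf = exp (v t² / 2)`). [folklore] -/
theorem hasSubgaussianMGF_of_map_eq_gaussianReal {Ω : Type*} [MeasurableSpace Ω] {P : Measure Ω}
    {X : Ω → ℝ} {v : ℝ≥0} (hXm : AEMeasurable X P) (hX : P.map X = gaussianReal 0 v) :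
    HasSubgaussianMGF X v P where
  integrable_exp_mul t := by
    have h : Integrable (fun x : ℝ ↦ Real.exp (t * x)) (P.map X) := by
      rw [hX]; exact integrable_exp_mul_gaussianReal t
    exact (integrable_map_measure h.aestronglyMeasurable hXm).1 h
  mgf_le t := by
    rw [mgf_gaussianReal hX t]
    simp

/-- Two-sided Gaussian tail bound: if `X ∼ 𝓝(0, v)` under a finite measure `P`, then
`P {ε ≤ |X|} ≤ 2 exp (-ε² / (2v))` (Chernoff). [folklore] -/
theorem measure_le_abs_le_of_map_eq_gaussianReal {Ω : Type*} [MeasurableSpace Ω] {P : Measure Ω}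
    [IsFiniteMeasure P] {X : Ω → ℝ} {v : ℝ≥0} (hXm : AEMeasurable X P)
    (hX : P.map X = gaussianReal 0 v) {ε : ℝ} (hε : 0 ≤ ε) :
    P {ω | ε ≤ |X ω|} ≤ ENNReal.ofReal (2 * Real.exp (-ε ^ 2 / (2 * v))) := by
  have hsg := hasSubgaussianMGF_of_map_eq_gaussianReal hXm hX
  have h1 := hsg.measure_ge_le hε
  have h2 := hsg.neg.measure_ge_le hε
  have hsub : {ω | ε ≤ |X ω|} ⊆ {ω | ε ≤ X ω} ∪ {ω | ε ≤ (-X) ω} := by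
    intro ω hω
    simp only [mem_setOf_eq, mem_union, Pi.neg_apply] at hω ⊢
    exact le_abs.1 hω
  have e1 : P {ω | ε ≤ X ω} = ENNReal.ofReal (P.real {ω | ε ≤ X ω}) := by
    rw [measureReal_def, ENNReal.ofReal_toReal (measure_ne_top _ _)]
  have e2 : P {ω | ε ≤ (-X) ω} = ENNReal.ofReal (P.real {ω | ε ≤ (-X) ω}) := by
    rw [measureReal_def, ENNReal.ofReal_toReal (measure_ne_top _ _)]
  calc P {ω | ε ≤ |X ω|} ≤ P ({ω | ε ≤ X ω} ∪ {ω | ε ≤ (-X) ω}) := measure_mono hsub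
    _ ≤ P {ω | ε ≤ X ω} + P {ω | ε ≤ (-X) ω} := measure_union_le _ _
    _ = ENNReal.ofReal (P.real {ω | ε ≤ X ω}) + ENNReal.ofReal (P.real {ω | ε ≤ (-X) ω}) := by
        rw [← e1, ← e2]
    _ ≤ ENNReal.ofReal (Real.exp (-ε ^ 2 / (2 * v))) +
        ENNReal.ofReal (Real.exp (-ε ^ 2 / (2 * v))) :=
        add_le_add (ENNReal.ofReal_le_ofReal h1) (ENNReal.ofReal_le_ofReal h2)
    _ = ENNReal.ofReal (2 * Real.exp (-ε ^ 2 / (2 * v))) := by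
        rw [← ENNReal.ofReal_add (by positivity) (by positivity)]
        congr 1
        ring

/-- Under the existence fact, the pre-Wiener measure is a probability measure (the law of
`brownian 0` is a probability measure). [folklore] -/
theorem isProbabilityMeasure_of_exists (h : exists_isBrownianReal_measurable_continuous) :
    IsProbabilityMeasure preWienerMeasure :=
  (isBrownianReal_brownian h).toIsPreBrownianReal.isGaussianProcess.isProbabilityMeasure

/-- If the existence fact fails, the canonical Brownian motion is the zero process (junk value).
[folklore] -/
theorem brownian_of_not (h : ¬ exists_isBrownianReal_measurable_continuous) : brownian = 0 := by
  unfold exists_isBrownianReal_measurable_continuous at h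
  unfold brownian
  rw [dif_neg h]

/-- The variance of a level-`m` dyadic increment: `nndist (dyad m (k+1)) (dyad m k) = 2⁻ᵐ`.
[folklore] -/
theorem coe_nndist_dyad_succ (m k : ℕ) :
    ((nndist (dyad m (k + 1)).1 (dyad m k).1 : ℝ≥0) : ℝ) = ((2 : ℝ) ^ m)⁻¹ := by
  rw [coe_nndist]
  change dist (dyad m (k + 1)) (dyad m k) = _
  rw [dist_comm, dist_dyad_succ]

/-- The threshold at level `m`: `scaleBound m = 2 √(m / 2ᵐ)` (two standard deviations times `√m`).
[folklore] -/
noncomputable def scaleBound (m : ℕ) : ℝ := 2 * Real.sqrt (m / 2 ^ m)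

/-- `scaleBound m ≥ 0`. [folklore] -/
theorem scaleBound_nonneg (m : ℕ) : 0 ≤ scaleBound m := by unfold scaleBound; positivity

/-- The Chernoff exponent at level `m`: `(scaleBound m)² / (2 · 2⁻ᵐ) = 2m`. [folklore] -/
theorem scaleBound_sq_div (m : ℕ) : scaleBound m ^ 2 / (2 * ((2 : ℝ) ^ m)⁻¹) = 2 * m := by
  unfold scaleBound
  rw [mul_pow, Real.sq_sqrt (by positivity)]
  field_simp

/-- **Gaussian tail at the dyadic scale.** Under the existence fact, for every level `m` and
every `k`, `P {scaleBound m ≤ |B((k+1)/2ᵐ) - B(k/2ᵐ)|} ≤ 2 e^{-2m}`. [folklore] -/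
theorem measure_increment_ge_le (h : exists_isBrownianReal_measurable_continuous) (m k : ℕ) :
    preWienerMeasure {ω | scaleBound m ≤ |brownian (dyad m (k + 1)) ω - brownian (dyad m k) ω|} ≤
      ENNReal.ofReal (2 * Real.exp (-(2 * m))) := by
  haveI := isProbabilityMeasure_of_exists h
  have hl := hasLaw_brownian_sub h (dyad m (k + 1)) (dyad m k)
  have key :=
    measure_le_abs_le_of_map_eq_gaussianReal hl.aemeasurable hl.map_eq (scaleBound_nonneg m)
  have hv : -scaleBound m ^ 2 / (2 * ((nndist (dyad m (k + 1)).1 (dyad m k).1 : ℝ≥0) : ℝ)) =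
      -(2 * m) := by
    rw [coe_nndist_dyad_succ, neg_div, scaleBound_sq_div]
  rw [hv] at key
  simpa only [Pi.sub_apply] using key

/-- `2 e⁻² < 1`. [folklore] -/
theorem two_mul_exp_neg_two_lt_one : 2 * Real.exp (-2) < 1 := by
  have h : (3 : ℝ) < Real.exp 2 := by
    have := Real.add_one_lt_exp (by norm_num : (2 : ℝ) ≠ 0)
    linarith
  rw [Real.exp_neg, ← div_eq_mul_inv, div_lt_one (Real.exp_pos 2)]
  linarith

/-- **Borel–Cantelli at the dyadic scales.** For every `N`, almost surely, for all sufficiently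
fine levels `m`, every increment of the canonical Brownian motion over consecutive level-`m`
dyadics of `[0, N]` is at most `scaleBound m = 2 √(m 2⁻ᵐ)`: the level-`m` failure
probability is at most
`N 2ᵐ · 2 e^{-2m} = 2N (2/e²)ᵐ`, which is summable. [cite: Lawler2005, Prop. 1.37 (proof)] -/
theorem ae_eventually_increments_le (N : ℕ) :
    ∀ᵐ ω ∂preWienerMeasure, ∀ᶠ m in atTop, ∀ k, k + 1 ≤ N * 2 ^ m →
      |brownian (dyad m (k + 1)) ω - brownian (dyad m k) ω| ≤ scaleBound m := by
  by_cases h : exists_isBrownianReal_measurable_continuous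
  swap
  · refine ae_of_all _ fun ω ↦ Eventually.of_forall fun m k _ ↦ ?_
    simp [brownian_of_not h, scaleBound_nonneg]
  set P := preWienerMeasure with hP
  set A : ℕ → Set (ℝ≥0 → ℝ) := fun m ↦ ⋃ k ∈ Finset.range (N * 2 ^ m),
    {ω | scaleBound m ≤ |brownian (dyad m (k + 1)) ω - brownian (dyad m k) ω|} with hA
  set r : ℝ := 2 * Real.exp (-2) with hr
  have hr0 : 0 ≤ r := by positivity
  have hr1 : r < 1 := two_mul_exp_neg_two_lt_one
  have hbound : ∀ m, P (A m) ≤ ENNReal.ofReal (2 * N * r ^ m) := by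
    intro m
    calc P (A m) ≤ ∑ k ∈ Finset.range (N * 2 ^ m),
          P {ω | scaleBound m ≤ |brownian (dyad m (k + 1)) ω - brownian (dyad m k) ω|} :=
          measure_biUnion_finset_le _ _
      _ ≤ ∑ _k ∈ Finset.range (N * 2 ^ m), ENNReal.ofReal (2 * Real.exp (-(2 * m))) :=
          Finset.sum_le_sum fun k _ ↦ measure_increment_ge_le h m k
      _ = ENNReal.ofReal ((N * 2 ^ m : ℕ) * (2 * Real.exp (-(2 * m)))) := by
          rw [Finset.sum_const, Finset.card_range, nsmul_eq_mul,
            ENNReal.ofReal_mul (Nat.cast_nonneg _), ENNReal.ofReal_natCast]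
      _ = ENNReal.ofReal (2 * N * r ^ m) := by
          congr 1
          rw [hr, mul_pow, ← Real.exp_nat_mul]
          push_cast
          ring_nf
  have hsum : ∑' m, P (A m) ≠ ∞ := by
    refine ne_top_of_le_ne_top ?_ (ENNReal.tsum_le_tsum hbound)
    rw [← ENNReal.ofReal_tsum_of_nonneg (fun m ↦ by positivity)
      ((summable_geometric_of_lt_one hr0 hr1).mul_left _)]
    exact ENNReal.ofReal_ne_top
  filter_upwards [ae_eventually_notMem hsum] with ω hω
  filter_upwards [hω] with m hm k hk
  simp only [hA, Set.mem_iUnion, Finset.mem_range, Set.mem_setOf_eq, not_exists, not_le,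
    exists_prop, not_and] at hm
  exact (hm k (by omega)).le

/-! ### The tail sums `∑_{l > n} scaleBound l` -/

/-- The comparison sequence `tailWeight i = √((1 + i) / 2ⁱ)`. [folklore] -/
noncomputable def tailWeight (i : ℕ) : ℝ := Real.sqrt ((1 + i) / 2 ^ i)

/-- `tailWeight i ≥ 0`. [folklore] -/
theorem tailWeight_nonneg (i : ℕ) : 0 ≤ tailWeight i := Real.sqrt_nonneg _

/-- `∑ᵢ √((1 + i)/2ⁱ) < ∞` (compare with `∑ (1 + i) (1/√2)ⁱ`). [folklore] -/
theorem summable_tailWeight : Summable tailWeight := by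
  have hq : ‖(Real.sqrt 2)⁻¹‖ < 1 := by
    rw [norm_inv, Real.norm_eq_abs, abs_of_pos (Real.sqrt_pos.2 two_pos), inv_lt_one_iff₀]
    exact Or.inr (Real.lt_sqrt zero_le_one |>.2 (by norm_num))
  have h1 : Summable fun i : ℕ ↦ ((i : ℝ) ^ 1 : ℝ) * (Real.sqrt 2)⁻¹ ^ i :=
    summable_pow_mul_geometric_of_norm_lt_one 1 hq
  have h0 : Summable fun i : ℕ ↦ (Real.sqrt 2)⁻¹ ^ i :=
    summable_geometric_of_norm_lt_one hq
  refine .of_nonneg_of_le tailWeight_nonneg (fun i ↦ ?_) (h0.add h1)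
  -- `√((1+i)/2^i) ≤ (1+i)/√2^i = (1 + i) (1/√2)^i`
  have h2i : Real.sqrt ((2 : ℝ) ^ i) = Real.sqrt 2 ^ i := by
    rw [Real.sqrt_eq_rpow, Real.sqrt_eq_rpow, ← Real.rpow_natCast, ← Real.rpow_natCast,
      ← Real.rpow_mul (by norm_num), ← Real.rpow_mul (by norm_num), mul_comm]
  unfold tailWeight
  rw [Real.sqrt_div (by positivity), h2i, pow_one]
  have e : (Real.sqrt 2)⁻¹ ^ i + (i : ℝ) * (Real.sqrt 2)⁻¹ ^ i = (1 + i) / Real.sqrt 2 ^ i := by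
    rw [inv_pow]; ring
  rw [e]
  gcongr
  exact Real.sqrt_le_iff.2 ⟨by positivity, by nlinarith⟩

/-- `scaleBound (n + 1 + i) ≤ scaleBound (n + 1) · tailWeight i`, since
`n + 1 + i ≤ (n + 1)(1 + i)`. [folklore] -/
theorem scaleBound_add_le (n i : ℕ) :
    scaleBound (n + 1 + i) ≤ scaleBound (n + 1) * tailWeight i := by
  unfold scaleBound tailWeight
  rw [mul_assoc, ← Real.sqrt_mul (by positivity)]
  gcongr
  rw [div_mul_div_comm, ← pow_add]
  gcongr
  push_cast
  nlinarith [Nat.cast_nonneg (α := ℝ) n, Nat.cast_nonneg (α := ℝ) i]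

/-- The shifted sequence `i ↦ scaleBound (n + 1 + i)` is summable. [folklore] -/
theorem summable_scaleBound_shift (n : ℕ) : Summable fun i ↦ scaleBound (n + 1 + i) :=
  .of_nonneg_of_le (fun _ ↦ scaleBound_nonneg _) (scaleBound_add_le n)
    (summable_tailWeight.mul_left _)

/-- The tail bound `∑ᵢ scaleBound (n + 1 + i) ≤ scaleBound (n + 1) ∑ᵢ tailWeight i`.
[folklore] -/
theorem tsum_scaleBound_shift_le (n : ℕ) :
    ∑' i, scaleBound (n + 1 + i) ≤ scaleBound (n + 1) * ∑' i, tailWeight i := by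
  rw [← tsum_mul_left]
  exact (summable_scaleBound_shift n).tsum_le_tsum (scaleBound_add_le n)
    (summable_tailWeight.mul_left _)

/-! ### Chaining on the dyadics and passage to all times -/

/-- **Scale-`n` modulus on the dyadics** (Lévy's chaining): if the increments of `f : ℝ≥0 → ℝ`
over consecutive level-`m` dyadics of `[0, N]` are `≤ scaleBound m` for all `m ≥ n₀`, then dyadic
`s, t ≤ N` with `|s - t| < 2⁻ⁿ`, `n ≥ n₀`, satisfy `|f s - f t| ≤ 2 scaleBound(n+1) ∑ᵢ tailWeight i`
(`Literature.Probability.Process.KolmogorovChentsov.edist_le_tsum_of_increments_le` and the tail bound).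
[cite: Legall2016, Lemma 2.10] -/
theorem dist_le_of_increments_le {f : ℝ≥0 → ℝ} {N n₀ n : ℕ} (hn : n₀ ≤ n)
    (h : ∀ m, n₀ ≤ m → ∀ k, k + 1 ≤ N * 2 ^ m → |f (dyad m (k + 1)) - f (dyad m k)| ≤ scaleBound m)
    {s t : ℝ≥0} (hs : s ∈ dyadics) (ht : t ∈ dyadics) (hsN : s ≤ N) (htN : t ≤ N)
    (hd : dist s t < (2 ^ n)⁻¹) :
    dist (f s) (f t) ≤ 2 * (scaleBound (n + 1) * ∑' i, tailWeight i) := by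
  have h' : ∀ m, n₀ < m → ∀ k, k + 1 ≤ N * 2 ^ m →
      edist (f (dyad m k)) (f (dyad m (k + 1))) ≤ ENNReal.ofReal (scaleBound m) := by
    intro m hm k hk
    rw [edist_comm, edist_dist, Real.dist_eq]
    exact ENNReal.ofReal_le_ofReal (h m hm.le k hk)
  have key := edist_le_tsum_of_increments_le (δ := fun m ↦ ENNReal.ofReal (scaleBound m)) hn h'
    hs ht hsN htN hd
  rw [← ENNReal.ofReal_tsum_of_nonneg (fun i ↦ scaleBound_nonneg _) (summable_scaleBound_shift n),
    edist_dist, ← ENNReal.ofReal_ofNat, ← ENNReal.ofReal_mul (by norm_num),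
    ENNReal.ofReal_le_ofReal_iff
      (mul_nonneg zero_le_two (tsum_nonneg fun _ ↦ scaleBound_nonneg _))] at key
  exact key.trans (by gcongr; exact tsum_scaleBound_shift_le n)

/-- A near-diagonal bound on the dyadics of `[0, N]` passes to all points of `[0, N]` for a
continuous path. [folklore] -/
theorem dist_le_of_dyadics {g : ℝ≥0 → ℝ} (hg : Continuous g) {N : ℕ} {ρ B : ℝ}
    (h : ∀ s ∈ dyadics, ∀ t ∈ dyadics, s ≤ N → t ≤ N → dist s t < ρ → dist (g s) (g t) ≤ B)
    {s t : ℝ≥0} (hs : s ≤ N) (ht : t ≤ N) (hd : dist s t < ρ) : dist (g s) (g t) ≤ B := by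
  set u : ℝ≥0 → ℕ → ℝ≥0 := fun x m ↦ dyad m ⌊(x : ℝ) * 2 ^ m⌋₊ with hu
  have hus : Tendsto (u s) atTop (𝓝 s) := (tendsto_dyad_floor s).mono_right nhdsWithin_le_nhds
  have hut : Tendsto (u t) atTop (𝓝 t) := (tendsto_dyad_floor t).mono_right nhdsWithin_le_nhds
  have hL : Tendsto (fun m ↦ dist (g (u s m)) (g (u t m))) atTop (𝓝 (dist (g s) (g t))) :=
    ((hg.tendsto s).comp hus).dist ((hg.tendsto t).comp hut)
  refine le_of_tendsto hL ?_
  have hev : ∀ᶠ m in atTop, dist (u s m) (u t m) < ρ :=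
    ((continuous_dist.tendsto (s, t)).comp (hus.prodMk_nhds hut)).eventually (gt_mem_nhds hd)
  filter_upwards [hev] with m hm
  exact h _ (dyad_mem_dyadics _ _) _ (dyad_mem_dyadics _ _) ((dyad_floor_le s m).trans hs)
    ((dyad_floor_le t m).trans ht) hm

/-! ### Lévy's modulus of continuity for the canonical Brownian motion -/

/-- The constant `levyConst = 2 ∑ᵢ √((1 + i)/2ⁱ)` of the scale-`n` modulus. [folklore] -/
noncomputable def levyConst : ℝ := 2 * ∑' i, tailWeight i

/-- `levyConst ≥ 0`. [folklore] -/
theorem levyConst_nonneg : 0 ≤ levyConst :=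
  mul_nonneg zero_le_two (tsum_nonneg tailWeight_nonneg)

/-- **Lévy's modulus of continuity, scale form.** For every horizon `N`, almost surely there is
a level `n₀` such that for all `n ≥ n₀` and all `s, t ≤ N` with `|s - t| < 2⁻ⁿ`,
`|B(s) - B(t)| ≤ levyConst · scaleBound (n + 1) = 2 levyConst √((n + 1) 2^{-(n+1)})` — i.e.
`|B(s) - B(t)| ≤ C √(h log(1/h))`
at the dyadic scales `h = 2⁻ⁿ`. (Upper half of Lévy's theorem with a non-sharp constant; only
the Gaussian tails of single increments, Borel–Cantelli and path continuity are used — no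
independence.) [cite: Lawler2005, Prop. 1.37 and Cor. 1.38] -/
theorem ae_exists_modulus_scale (N : ℕ) :
    ∀ᵐ ω ∂preWienerMeasure, ∃ n₀ : ℕ, ∀ n, n₀ ≤ n → ∀ s t : ℝ≥0, s ≤ N → t ≤ N →
      dist s t < (2 ^ n)⁻¹ → |brownian s ω - brownian t ω| ≤ levyConst * scaleBound (n + 1) := by
  filter_upwards [ae_eventually_increments_le N] with ω hω
  obtain ⟨n₀, hn₀⟩ := eventually_atTop.1 hω
  refine ⟨n₀, fun n hn s t hs ht hd ↦ ?_⟩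
  have hmain : ∀ s ∈ dyadics, ∀ t ∈ dyadics, s ≤ N → t ≤ N → dist s t < (2 ^ n)⁻¹ →
      dist (brownian s ω) (brownian t ω) ≤ 2 * (scaleBound (n + 1) * ∑' i, tailWeight i) :=
    fun s hs t ht hsN htN hd ↦
      dist_le_of_increments_le (f := fun u ↦ brownian u ω) hn hn₀ hs ht hsN htN hd
  have := dist_le_of_dyadics (continuous_brownian ω) hmain hs ht hd
  rw [Real.dist_eq] at this
  convert this using 1
  unfold levyConst; ring

/-- `scaleBound (2j) = 2 √2 · √j · 2^{-j}`. [folklore] -/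
theorem scaleBound_two_mul (j : ℕ) :
    scaleBound (2 * j) = 2 * Real.sqrt 2 * Real.sqrt j * ((2 : ℝ) ^ j)⁻¹ := by
  unfold scaleBound
  have h4 : (2 : ℝ) ^ (2 * j) = (2 ^ j) ^ 2 := by rw [pow_mul, pow_right_comm]
  rw [h4, Nat.cast_mul, Nat.cast_ofNat, Real.sqrt_div (by positivity), Real.sqrt_sq (by positivity),
    Real.sqrt_mul (by norm_num)]
  ring

/-- **Lévy's modulus of continuity, dyadic `4^{-j}` form** (the form of hypothesis (4.28) of
Lawler's Lemma 4.33): for every horizon `N`, almost surely there are `c ≥ 0` and `j₀` such that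
`|B(t + s) - B(t)| ≤ c √j 2^{-j}` for all `j ≥ j₀`, `t ≤ N` and `s ≤ 4^{-j}`.
[cite: Lawler2005, Cor. 1.38] -/
theorem ae_exists_modulus_dyadic (N : ℕ) :
    ∀ᵐ ω ∂preWienerMeasure, ∃ (c : ℝ) (j₀ : ℕ), 0 ≤ c ∧
      ∀ j : ℕ, j₀ ≤ j → ∀ t s : ℝ≥0, (t : ℝ) ≤ N → (s : ℝ) ≤ ((4 : ℝ) ^ j)⁻¹ →
        |brownian (t + s) ω - brownian t ω| ≤ c * Real.sqrt j * ((2 : ℝ) ^ j)⁻¹ := by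
  filter_upwards [ae_exists_modulus_scale (N + 1)] with ω ⟨n₀, hn₀⟩
  refine ⟨levyConst * (2 * Real.sqrt 2), n₀ + 1, by have := levyConst_nonneg; positivity, ?_⟩
  intro j hj t s ht hs
  have hj1 : 1 ≤ j := le_trans (Nat.le_add_left 1 n₀) hj
  -- the scale `n = 2j - 1 ≥ n₀`, `n + 1 = 2j`
  have hn : n₀ ≤ 2 * j - 1 := by omega
  have hn1 : 2 * j - 1 + 1 = 2 * j := by omega
  have hs1 : (s : ℝ) ≤ 1 := hs.trans (inv_le_one_of_one_le₀ (one_le_pow₀ (by norm_num)))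
  have htN : t + s ≤ (↑(N + 1) : ℝ≥0) := by
    rw [← NNReal.coe_le_coe]; push_cast; linarith
  have htN' : t ≤ (↑(N + 1) : ℝ≥0) := le_trans le_self_add htN
  have hd : dist (t + s) t < (2 ^ (2 * j - 1))⁻¹ := by
    rw [NNReal.dist_eq, NNReal.coe_add, add_sub_cancel_left, NNReal.abs_eq]
    refine hs.trans_lt ?_
    rw [inv_lt_inv₀ (by positivity) (by positivity)]
    calc (2 : ℝ) ^ (2 * j - 1) < 2 ^ (2 * j - 1 + 1) := pow_lt_pow_right₀ (by norm_num) (by omega)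
      _ = 4 ^ j := by rw [hn1, pow_mul]; norm_num
  have key := hn₀ (2 * j - 1) hn (t + s) t htN htN' hd
  rw [hn1, scaleBound_two_mul] at key
  convert key using 1
  ring

/-- `scaleBound(n+1)² ≤ (8 / log 2) · d log(1/d)` when `2^{-(n+1)} ≤ d < 2^{-n}` and `d ≤ 1/2`.
[folklore] -/
theorem scaleBound_sq_le_of_scale {n : ℕ} {d : ℝ} (hd0 : 0 < d) (hd2 : d ≤ 1 / 2)
    (h1 : ((2 : ℝ) ^ (n + 1))⁻¹ ≤ d) (h2 : d < ((2 : ℝ) ^ n)⁻¹) :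
    scaleBound (n + 1) ^ 2 ≤ 8 / Real.log 2 * (d * Real.log (1 / d)) := by
  have hL : 0 < Real.log 2 := Real.log_pos one_lt_two
  -- `n log 2 < log (1/d)` and `log 2 ≤ log (1/d)`
  have hn : (n : ℝ) * Real.log 2 < Real.log (1 / d) := by
    rw [← Real.log_pow]
    exact Real.log_lt_log (by positivity) (by rwa [one_div, lt_inv_comm₀ (by positivity) hd0])
  have hl2 : Real.log 2 ≤ Real.log (1 / d) :=
    Real.log_le_log two_pos (by rw [one_div, le_inv_comm₀ two_pos hd0]; rwa [one_div] at hd2)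
  have hn1 : ((n : ℝ) + 1) * Real.log 2 ≤ 2 * Real.log (1 / d) := by linarith
  have hscaleBound : scaleBound (n + 1) ^ 2 = 4 * ((n : ℝ) + 1) * ((2 : ℝ) ^ (n + 1))⁻¹ := by
    unfold scaleBound
    rw [mul_pow, Real.sq_sqrt (by positivity)]
    push_cast
    ring
  rw [hscaleBound]
  calc 4 * ((n : ℝ) + 1) * ((2 : ℝ) ^ (n + 1))⁻¹ ≤ 4 * ((n : ℝ) + 1) * d := by gcongr
    _ = 4 / Real.log 2 * (d * (((n : ℝ) + 1) * Real.log 2)) := by field_simp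
    _ ≤ 4 / Real.log 2 * (d * (2 * Real.log (1 / d))) := by gcongr
    _ = 8 / Real.log 2 * (d * Real.log (1 / d)) := by ring

/-- **Lévy's modulus of continuity of Brownian motion (upper bound).** For every horizon `N`,
almost surely there is `h₀ > 0` such that
`|B(s) - B(t)| ≤ levyConst √(8 / log 2) · √(|s - t| log(1/|s - t|))` for all `s, t ≤ N` with
`|s - t| ≤ h₀`. (Lévy (1937); Lawler (2005), Prop. 1.37 / Cor. 1.38 give the sharp constant
`limsup osc(B, δ)/√(δ log(1/δ)) ≤ 6`, resp. `= √2` classically; here the constant is not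
optimised.) [cite: Lawler2005, Cor. 1.38] -/
theorem ae_exists_modulus (N : ℕ) :
    ∀ᵐ ω ∂preWienerMeasure, ∃ h₀ : ℝ, 0 < h₀ ∧ ∀ s t : ℝ≥0, s ≤ N → t ≤ N → dist s t ≤ h₀ →
      |brownian s ω - brownian t ω| ≤
        levyConst * Real.sqrt (8 / Real.log 2) *
          Real.sqrt (dist s t * Real.log (1 / dist s t)) := by
  filter_upwards [ae_exists_modulus_scale N] with ω ⟨n₀, hn₀⟩
  refine ⟨((2 : ℝ) ^ (n₀ + 1))⁻¹, by positivity, fun s t hs ht hd ↦ ?_⟩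
  rcases eq_or_ne s t with rfl | hst
  · simp
  set d : ℝ := dist s t with hd_def
  have hd0 : 0 < d := dist_pos.2 hst
  have hd2 : d ≤ 1 / 2 := hd.trans (by
    rw [pow_succ, mul_inv, one_div]
    exact mul_le_of_le_one_left (by norm_num) (inv_le_one_of_one_le₀ (one_le_pow₀ (by norm_num))))
  have hdn₀ : d < ((2 : ℝ) ^ n₀)⁻¹ := hd.trans_lt (by
    rw [inv_lt_inv₀ (by positivity) (by positivity)]
    exact pow_lt_pow_right₀ (by norm_num) (Nat.lt_succ_self _))
  -- the scale: the least `m` with `2^{-m} ≤ d` is `≥ 1`; `n = m - 1`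
  have hex : ∃ m : ℕ, ((2 : ℝ) ^ m)⁻¹ ≤ d := by
    obtain ⟨m, hm⟩ := exists_pow_lt_of_lt_one hd0 (by norm_num : (2⁻¹ : ℝ) < 1)
    exact ⟨m, by rw [← inv_pow]; exact hm.le⟩
  classical
  have hm1 : 1 ≤ Nat.find hex := by
    by_contra h0
    have h00 : Nat.find hex = 0 := by omega
    have hm := Nat.find_spec hex
    rw [h00, pow_zero, inv_one] at hm
    linarith
  set n := Nat.find hex - 1 with hn_def
  have hmn : Nat.find hex = n + 1 := by omega
  have hm : ((2 : ℝ) ^ (n + 1))⁻¹ ≤ d := hmn ▸ Nat.find_spec hex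
  have h2 : d < ((2 : ℝ) ^ n)⁻¹ := by
    have := Nat.find_min hex (m := n) (by omega)
    exact not_le.1 this
  have hn : n₀ ≤ n := by
    by_contra hlt
    have : ((2 : ℝ) ^ (n₀ + 1))⁻¹ < ((2 : ℝ) ^ (n + 1))⁻¹ := by
      rw [inv_lt_inv₀ (by positivity) (by positivity)]
      exact pow_lt_pow_right₀ (by norm_num) (by omega)
    linarith
  have key := hn₀ n hn s t hs ht h2
  refine key.trans ?_
  rw [mul_assoc, ← Real.sqrt_mul (by positivity)]
  gcongr
  · exact levyConst_nonneg
  · calc scaleBound (n + 1) = Real.sqrt (scaleBound (n + 1) ^ 2) :=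
          (Real.sqrt_sq (scaleBound_nonneg _)).symm
      _ ≤ _ := Real.sqrt_le_sqrt (scaleBound_sq_le_of_scale hd0 hd2 hm h2)

end LevyModulus

end Literature.Probability.Process
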